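import Literature.NumberTheory.EllipticCurves.DivisionPolynomialFormalMulProofs
import Literature.NumberTheory.EllipticCurves.UniversalOrdinaryRing
import Literature.RingTheory.HenselLemma.Factorization
import Mathlib.Algebra.CharP.Quotient
import HarnessLib

/-!
# The Hensel factor of the `p`-division polynomial of an ordinary curve over a `p`-adically
# complete ring (Blakestad–Grant 2023, eq. (4); proofs only)

Trunk T-NT-EC (Literature/NumberTheory/EllipticCurves). Blakestad–Grant (*On the universal
`p`-adic sigma and Weierstrass zeta functions*, J. Number Theory 249 (2023), arXiv:1903.02480,
proof of Prop. 7) split the `p`-division polynomial `φ_p(x) = px^{(p²-1)/2} + Σ ℓₙxⁿ` of the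
universal ordinary curve over `R̂` by "the `p`-adic Weierstrass preparation theorem":

  `φ_p(x) = φ_ψ(x)·ξ_ψ(x)`,  `ξ_ψ ∈ R̂[x]` monic,
  `φ_ψ(x) = px^{(p-1)/2} + ℓ̃_{(p-3)/2}x^{(p-3)/2} + ⋯ + ℓ̃₀`,  `φ_ψ(x) ≡ ℓ_{p(p-1)/2} (mod p)`,  (4)

"`ℓ_{p(p-1)/2}` … is invertible in `R̂`, since … it reduces to `H` mod `p`" (`H` the Hasse
invariant). This file proves (4) for every Weierstrass curve `V` over every commutative ring `𝒪`
which is complete for the `p`-adic topology, with `𝒪/p` an integral domain and the Hasse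
coefficient `A_p(V)` (`WeierstrassCurve.hasseCoeff`, Silverman AEC V.4.1(a)) a unit
(`p = 2n + 1` an odd prime):

* **`WeierstrassCurve.exists_henselFactor_preΨ'`** — there are `φ, ξ ∈ 𝒪[X]` with
  `preΨ'_p = φ·ξ`, `ξ` monic of degree `pn = (p²-p)/2`, `deg φ ≤ n`, `φₙ = p`, `φ₀ ∈ 𝒪ˣ`,
  `φᵢ ∈ p𝒪` for `i ≥ 1`, and `φ₀² ≡ A_p(V)² (mod p)`.
  Ingredients: modulo `p`, `ΨSq_p = (preΨ'_p)²` has degree `p² - p` and leading coefficient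
  `A_p²` for an ordinary curve (the tree's `natDegree_ΨSq_prime_eq`, `leadingCoeff_ΨSq_prime_eq`,
  `DivisionPolynomialFormalMulProofs` — from `[p](z) ≡ A_p zᵖ + ⋯`), so `preΨ'_p mod p` has degree
  `pn` with leading coefficient `±A_p`, a unit; the tree's adic Weierstrass preparation for
  polynomials (`Literature.RingTheory.HenselLemma.exists_monic_mul_eq_of_coeff_mem`, Bourbaki
  AC III §4 no. 3) then splits off the monic factor `ξ` of degree `pn`, with cofactor
  `φ ≡ (preΨ'_p)_{pn} (mod p)` a constant modulo `p`, whose constant term is a unit because units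
  lift along `𝒪 → 𝒪/p` (`Literature.RingTheory.AdicTopology.isUnit_of_isUnit_mk`);
  `deg φ ≤ (p²-1)/2 - pn = n` and
  `φₙ = (preΨ'_p)_{(p²-1)/2} = p` (Mathlib `natDegree_preΨ'_le`, `coeff_preΨ'`).
  (The sign in `φ₀ ≡ ±A_p` is not determined here; Blakestad–Grant quote `ℓ_{p(p-1)/2} ≡ H` from
  [Debry 2014]. Both models `E'_{±γ}` of the quotient coincide, so the sign is immaterial for
  their Prop. 7.)
* `UniversalOrdinary.exists_henselFactor_preΨ'_universalCurve` — the case of the universal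
  ordinary curve `𝓔 : y² = x³ + A₄x + A₆` over `R̂ = ℤ[A₄,A₆][1/H]^∧_p`, `p ≥ 5`
  (`UniversalOrdinaryRing`: `R̂` is `p`-adically complete, `(p)` is prime, `H` is a unit).

Together with `CanonicalSubgroupOfHenselFactorProofs` (the subgroup `G` of order `p` with
`x(G∖O) = roots(φ)`, `φ = p·veluD G`) this is the input `φ_ψ`, `hφ1`, `hℓ`, `hφF`, `hcard` of
`VeluKernelReductionProofs` on Blakestad–Grant's route to the tree's named fact
`WeierstrassCurve.mazur_tate_sigma_existsUnique` (Mazur–Stein–Tate 2006, Thm. 1.3).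

## Sources

* C. Blakestad, D. Grant, J. Number Theory 249 (2023) 348–376 (arXiv:1903.02480), §2.3, proof of
  Prop. 7, eq. (4) ("Applying the `p`-adic Weierstrass preparation theorem … `φ_p(x)` factors as
  a polynomial of the form `φ_ψ(x) := px^{(p-1)/2} + ⋯ + ℓ̃₀`, `φ_ψ(x) ≡ ℓ_{p(p-1)/2} ≡ H mod p`,
  times a monic polynomial `ξ_ψ(x) ∈ R̂[x]`"). [BlakestadGrant2023]
* N. Bourbaki, *Commutative Algebra*, Ch. III §4 no. 3, Th. 1 (Hensel), as vendored in
  `Literature/RingTheory/HenselLemma/Factorization.lean`. [Bourbaki1989CommAlg]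
* J. H. Silverman, *The Arithmetic of Elliptic Curves*, 2nd ed. (2009), V.3.1(a), V.4.1(a),
  Exercise 3.7(b) (`ψₙ = nx^{(n²-1)/2} + ⋯` for `n` odd). [SilvermanAEC2009]
* C. Debry, *Beyond two criteria for supersingularity: coefficients of division polynomials*,
  J. Théor. Nombres Bordeaux 26 (2014) 595–605 (the sign `ℓ_{p(p-1)/2} ≡ H`). [Debry2014]

Pure proof file: no definitions, no named facts.
-/

noncomputable section

open Polynomial

namespace WeierstrassCurve

variable {𝒪 : Type*} [CommRing 𝒪] (V : WeierstrassCurve 𝒪) (p n : ℕ) [Fact p.Prime]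

/-- **The Hensel factor `φ_ψ` of the `p`-division polynomial** (Blakestad–Grant's eq. (4)). Let
`𝒪` be complete for the `p`-adic topology with `𝒪/p` an integral domain, `p = 2n + 1` prime, and
`V/𝒪` a Weierstrass curve whose Hasse coefficient `A_p(V)` is a unit. Then
`preΨ'_p(V) = φ·ξ` with `ξ ∈ 𝒪[X]` monic of degree `pn`, `deg φ ≤ n`, `φₙ = p`, `φ₀ ∈ 𝒪ˣ`,
`φᵢ ∈ p𝒪` for all `i ≥ 1` (so `φ ≡ φ₀ (mod p)`), and `φ₀² ≡ A_p(V)² (mod p)`.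
[Blakestad–Grant 2023, eq. (4) and proof of Prop. 7] [cite: BlakestadGrant2023, Prop. 7] -/
theorem exists_henselFactor_preΨ' [IsAdicComplete (Ideal.span {(p : 𝒪)}) 𝒪]
    (hdom : IsDomain (𝒪 ⧸ Ideal.span {(p : 𝒪)})) (hpn : 2 * n + 1 = p)
    (hA : IsUnit (V.hasseCoeff p)) :
    ∃ φ ξ : 𝒪[X], V.preΨ' p = φ * ξ ∧ ξ.Monic ∧ ξ.natDegree = p * n ∧ φ.natDegree ≤ n ∧
      φ.coeff n = p ∧ IsUnit (φ.coeff 0) ∧ (∀ i, 1 ≤ i → φ.coeff i ∈ Ideal.span {(p : 𝒪)}) ∧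
      φ.coeff 0 ^ 2 - V.hasseCoeff p ^ 2 ∈ Ideal.span {(p : 𝒪)} := by
  have hp : p.Prime := Fact.out
  set I : Ideal 𝒪 := Ideal.span {(p : 𝒪)} with hI
  set mk := Ideal.Quotient.mk I with hmk
  haveI : IsDomain (𝒪 ⧸ I) := hdom
  have hItop : I ≠ ⊤ := by
    intro h
    have : Subsingleton (𝒪 ⧸ I) := Ideal.Quotient.subsingleton_iff.mpr h
    exact false_of_nontrivial_of_subsingleton (𝒪 ⧸ I)
  haveI : Nontrivial 𝒪 := ⟨⟨0, 1, fun h => hItop (Ideal.eq_top_of_isUnit_mem I I.zero_mem (h ▸ isUnit_one))⟩⟩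
  have hpnu : (p : 𝒪) ∈ nonunits 𝒪 := fun hu =>
    hItop (Ideal.eq_top_of_isUnit_mem I (Ideal.subset_span rfl) hu)
  haveI : CharP (𝒪 ⧸ I) p := CharP.quotient 𝒪 p hpnu
  have hp2 : p ≠ 2 := by have := hp.two_le; omega
  have hodd : ¬Even p := by rw [← hpn, Nat.not_even_iff_odd]; exact odd_two_mul_add_one n
  -- arithmetic of the degrees
  obtain ⟨m, hm⟩ : ∃ m, m = n ^ 2 := ⟨_, rfl⟩
  have hp2' : p ^ 2 = 4 * m + 4 * n + 1 := by rw [hm, ← hpn]; ring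
  have hpn' : p * n = 2 * m + n := by rw [hm, ← hpn]; ring
  have htop_deg : (p ^ 2 - 1) / 2 = p * n + n := by rw [hp2', hpn']; omega
  have hsq_deg : p ^ 2 - p = 2 * (p * n) := by rw [hp2', hpn', ← hpn]; omega
  -- the reduction `V̄` is ordinary
  set Vb := V.map mk with hVb
  have hAb : Vb.hasseCoeff p ≠ 0 := by
    rw [hVb, map_hasseCoeff]
    exact (hA.map mk).ne_zero
  -- `preΨ'_p mod p` has degree `pn` and leading coefficient `c̄` with `c̄² = Ā²`
  set f := V.preΨ' p with hf
  have hfb : f.map mk = Vb.preΨ' p := by rw [hVb, map_preΨ']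
  have hΨb : Vb.ΨSq (p : ℕ) = Vb.preΨ' p ^ 2 := by rw [ΨSq_ofNat, if_neg hodd, mul_one]
  have hdegΨ := Vb.natDegree_ΨSq_prime_eq p hp2 hAb
  have hlcΨ := Vb.leadingCoeff_ΨSq_prime_eq p hp2 hAb
  rw [hΨb] at hdegΨ hlcΨ
  rw [natDegree_pow] at hdegΨ
  rw [leadingCoeff_pow] at hlcΨ
  have hdegb : (f.map mk).natDegree = p * n := by rw [hfb]; omega
  have hlcb : (f.map mk).leadingCoeff ^ 2 = mk (V.hasseCoeff p) ^ 2 := by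
    rw [hfb, hlcΨ, hVb, map_hasseCoeff]
  -- the coefficient of `X^{pn}` of `f` is a unit modulo `p`
  have hcunit : IsUnit (mk (f.coeff (p * n))) := by
    have h1 : mk (f.coeff (p * n)) = (f.map mk).leadingCoeff := by
      rw [leadingCoeff, hdegb, coeff_map]
    rw [h1, ← isUnit_pow_iff two_ne_zero, hlcb]
    exact (hA.map mk).pow 2
  obtain ⟨cu, hcu⟩ := hcunit
  obtain ⟨c', hc'⟩ := Ideal.Quotient.mk_surjective (I := I) (↑cu⁻¹ : 𝒪 ⧸ I)
  have hc : f.coeff (p * n) * c' - 1 ∈ I := by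
    rw [← Ideal.Quotient.eq_zero_iff_mem, map_sub, map_mul, map_one, hc', ← hcu, Units.mul_inv, sub_self]
  have htop : ∀ i, p * n < i → f.coeff i ∈ I := by
    intro i hi
    rw [← Ideal.Quotient.eq_zero_iff_mem, ← coeff_map]
    exact coeff_eq_zero_of_natDegree_lt (hdegb ▸ hi)
  -- Hensel / adic Weierstrass preparation
  obtain ⟨g, h, hg, hgdeg, hhdeg, -, hhc, hfgh⟩ :=
    Literature.RingTheory.HenselLemma.exists_monic_mul_eq_of_coeff_mem I f (p * n) c' hc htop
  have hfdeg : f.natDegree ≤ p * n + n := by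
    have := V.natDegree_preΨ'_le p
    rw [if_neg hodd, htop_deg] at this
    exact this
  have hhn : h.natDegree ≤ n := hhdeg.trans (by omega)
  have hhcoeff : ∀ i, (h - C (f.coeff (p * n))).coeff i ∈ I := Ideal.mem_map_C_iff.mp hhc
  refine ⟨h, g, by rw [hfgh, mul_comm], hg, hgdeg, hhn, ?_, ?_, ?_, ?_⟩
  · -- `φₙ = p`
    have h1 : f.coeff (p * n + n) = h.coeff n := by
      rw [hfgh, coeff_mul_add_eq_of_natDegree_le hgdeg.le hhn, ← hgdeg, hg.coeff_natDegree, one_mul]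
    have h2 : f.coeff (p * n + n) = p := by
      have := V.coeff_preΨ' p
      rw [if_neg hodd, if_neg hodd, htop_deg] at this
      exact this
    rw [← h1, h2]
  · -- `φ₀` is a unit
    refine Literature.RingTheory.AdicTopology.isUnit_of_isUnit_mk I ?_
    have h0 := hhcoeff 0
    rw [coeff_sub, coeff_C_zero, ← Ideal.Quotient.eq] at h0
    rw [h0, ← hcu]
    exact Units.isUnit cu
  · intro i hi
    have := hhcoeff i
    rwa [coeff_sub, coeff_C, if_neg (by omega), sub_zero] at this
  · -- `φ₀² ≡ A_p²`
    have h0 := hhcoeff 0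
    rw [coeff_sub, coeff_C_zero, ← Ideal.Quotient.eq] at h0
    rw [← Ideal.Quotient.eq_zero_iff_mem, map_sub, map_pow, map_pow, h0, sub_eq_zero, ← hlcb, leadingCoeff,
      hdegb, coeff_map]

end WeierstrassCurve

/-! ### The universal ordinary curve -/

namespace Literature.NumberTheory.EllipticCurves.UniversalOrdinary

open WeierstrassCurve

/-- **Blakestad–Grant's (4) for the universal ordinary curve** `𝓔/R̂`, `p = 2n + 1 ≥ 5`:
`preΨ'_p(𝓔) = φ_ψ·ξ_ψ` with `ξ_ψ ∈ R̂[X]` monic of degree `pn`, `deg φ_ψ ≤ n`, `(φ_ψ)ₙ = p`,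
`ℓ̃₀ = φ_ψ(0) ∈ R̂ˣ`, `φ_ψ ≡ ℓ̃₀ (mod p)` and `ℓ̃₀² ≡ H² (mod p)`.
[Blakestad–Grant 2023, eq. (4)] [cite: BlakestadGrant2023, Prop. 7] -/
theorem exists_henselFactor_preΨ'_universalCurve (p n : ℕ) [Fact p.Prime] (hp5 : 5 ≤ p)
    (hpn : 2 * n + 1 = p) :
    ∃ φ ξ : (completeRing p)[X], (universalCurve p).preΨ' p = φ * ξ ∧ ξ.Monic ∧
      ξ.natDegree = p * n ∧ φ.natDegree ≤ n ∧ φ.coeff n = p ∧ IsUnit (φ.coeff 0) ∧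
      (∀ i, 1 ≤ i → φ.coeff i ∈ Ideal.span {(p : completeRing p)}) ∧
      φ.coeff 0 ^ 2 - (universalCurve p).hasseCoeff p ^ 2 ∈ Ideal.span {(p : completeRing p)} := by
  haveI := span_natCast_isPrime_completeRing p hp5
  exact (universalCurve p).exists_henselFactor_preΨ' p n (Ideal.Quotient.isDomain _) hpn
    (isUnit_hasseCoeff_universalCurve p)

end Literature.NumberTheory.EllipticCurves.UniversalOrdinary
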